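import Summits.CriticalPhenomena.PercolationContinuityZ3.Theorems.PercNearOneGluingNoHeavyLowerTailForestRayleighFivePinned
import Summits.CriticalPhenomena.PercolationContinuityZ3.Theorems.PercNearOneGluingNoHeavyLowerTailForestRayleighKFiveESub
import Summits.CriticalPhenomena.PercolationContinuityZ3.Theorems.PercNearOneGluingNoHeavyLowerTailForestRayleighKFiveETopA
import Summits.CriticalPhenomena.PercolationContinuityZ3.Theorems.PercNearOneGluingNoHeavyLowerTailForestRayleighKFiveETopB
import Summits.CriticalPhenomena.PercolationContinuityZ3.Theorems.PercNearOneGluingNoHeavyLowerTailForestRayleighKFiveETopC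
import HarnessLib

/-!
# Weighted forest negative correlation — `K₅ − e` is forest-Rayleigh  III: the theorem

`K₅ − 01` on `Fin 5` (3-connected, not in the Semple–Welsh class). `forestsW_rayleigh_K5e_fin`:
it has the weighted forest Rayleigh property. Proof as for `W₄` (`…Wheel`): pinned instances contract
to `K₄` (`lsm_of_pinned_fin5`); instances missing an edge live in `K₅ − {01,0x}` (2-sum of `K₄` and a
triangle) or in a copy of `W₄`; instances using all nine edges with nothing pinned are the six top
cells `…FiveTop7–12` up to symmetry. Theorems only; no definitions, no `sorry`.
-/

open Finset SimpleGraph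
open scoped Classical

namespace Summit.CriticalPhenomena.PercolationContinuityZ3.Theorems.ForestRayleigh

/-- `(R)` for the instances of `K5e` that use every edge with nothing pinned (`K = ∅`). -/
theorem K5e_full_top (w : Sym2 (Fin 5) → ℝ) (hw : ∀ x, 0 ≤ w x) (D : Finset (Sym2 (Fin 5)))
    (e f : Sym2 (Fin 5)) (hsub : D ∪ insert e (insert f (∅ : Finset (Sym2 (Fin 5)))) ⊆ ({s(0, 2), s(0, 3), s(0, 4), s(1, 2), s(1, 3), s(1, 4), s(2, 3), s(2, 4), s(3, 4)} : Finset (Sym2 (Fin 5))))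
    (hfull : ({s(0, 2), s(0, 3), s(0, 4), s(1, 2), s(1, 3), s(1, 4), s(2, 3), s(2, 4), s(3, 4)} : Finset (Sym2 (Fin 5))) ⊆ D ∪ insert e (insert f (∅ : Finset (Sym2 (Fin 5)))))
    (heD : e ∉ D) (hfD : f ∉ D) (hef : e ≠ f) :
    (∑ G ∈ D.powerset.filter (fun G =>
        (fromEdgeSet ((G ∪ (insert e (insert f (∅ : Finset (Sym2 (Fin 5))))) : Finset (Sym2 (Fin 5))) : Set (Sym2 (Fin 5)))).IsAcyclic), ∏ y ∈ G, w y) *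
      (∑ G ∈ D.powerset.filter (fun G =>
        (fromEdgeSet ((G ∪ ((∅ : Finset (Sym2 (Fin 5)))) : Finset (Sym2 (Fin 5))) : Set (Sym2 (Fin 5)))).IsAcyclic), ∏ y ∈ G, w y) ≤
    (∑ G ∈ D.powerset.filter (fun G =>
        (fromEdgeSet ((G ∪ (insert e (∅ : Finset (Sym2 (Fin 5)))) : Finset (Sym2 (Fin 5))) : Set (Sym2 (Fin 5)))).IsAcyclic), ∏ y ∈ G, w y) *
      (∑ G ∈ D.powerset.filter (fun G =>
        (fromEdgeSet ((G ∪ (insert f (∅ : Finset (Sym2 (Fin 5)))) : Finset (Sym2 (Fin 5))) : Set (Sym2 (Fin 5)))).IsAcyclic), ∏ y ∈ G, w y) := by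
  have he : e ∈ ({s(0, 2), s(0, 3), s(0, 4), s(1, 2), s(1, 3), s(1, 4), s(2, 3), s(2, 4), s(3, 4)} : Finset (Sym2 (Fin 5))) := hsub (by simp)
  have key : ∀ z : Sym2 (Fin 5), z ∈ ({s(0, 2), s(0, 3), s(0, 4), s(1, 2), s(1, 3), s(1, 4), s(2, 3), s(2, 4), s(3, 4)} : Finset (Sym2 (Fin 5))) → z ∈ ({s(0, 2), s(0, 3), s(0, 4)} : Finset (Sym2 (Fin 5))) ∨ z ∈ ({s(1, 2), s(1, 3), s(1, 4)} : Finset (Sym2 (Fin 5))) ∨ z ∈ ({s(2, 3), s(2, 4), s(3, 4)} : Finset (Sym2 (Fin 5))) := by decide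
  rcases key e he with h | h | h
  · exact K5e_full_top_1 w hw D e f hsub hfull heD hfD hef h
  · exact K5e_full_top_2 w hw D e f hsub hfull heD hfD hef h
  · exact K5e_full_top_3 w hw D e f hsub hfull heD hfD hef h

/-- **`K5e` on `Fin 5` has the weighted forest Rayleigh property**: `(R)(D;K;e,f)` for every
instance inside it and all activities. [top cells + contraction + deletion] -/
theorem forestsW_rayleigh_K5e_fin :
    ∀ (w : Sym2 (Fin 5) → ℝ), (∀ x, 0 ≤ w x) → ∀ (D K : Finset (Sym2 (Fin 5))) (e f : Sym2 (Fin 5)),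
      D ∪ insert e (insert f K) ⊆ ({s(0, 2), s(0, 3), s(0, 4), s(1, 2), s(1, 3), s(1, 4), s(2, 3), s(2, 4), s(3, 4)} : Finset (Sym2 (Fin 5))) → Disjoint D K → e ∉ D → e ∉ K → f ∉ D →
      f ∉ K → e ≠ f →
      (∑ G ∈ D.powerset.filter (fun G =>
        (fromEdgeSet ((G ∪ (insert e (insert f (K))) : Finset (Sym2 (Fin 5))) : Set (Sym2 (Fin 5)))).IsAcyclic), ∏ y ∈ G, w y) *
        (∑ G ∈ D.powerset.filter (fun G =>
        (fromEdgeSet ((G ∪ (K) : Finset (Sym2 (Fin 5))) : Set (Sym2 (Fin 5)))).IsAcyclic), ∏ y ∈ G, w y) ≤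
      (∑ G ∈ D.powerset.filter (fun G =>
        (fromEdgeSet ((G ∪ (insert e (K)) : Finset (Sym2 (Fin 5))) : Set (Sym2 (Fin 5)))).IsAcyclic), ∏ y ∈ G, w y) *
        (∑ G ∈ D.powerset.filter (fun G =>
        (fromEdgeSet ((G ∪ (insert f (K)) : Finset (Sym2 (Fin 5))) : Set (Sym2 (Fin 5)))).IsAcyclic), ∏ y ∈ G, w y) := by
  intro w hw D K e f hsub hDK heD heK hfD hfK hef
  have hL : ∀ z ∈ D ∪ insert e (insert f K), ¬z.IsDiag := by
    have hT : ∀ z ∈ ({s(0, 2), s(0, 3), s(0, 4), s(1, 2), s(1, 3), s(1, 4), s(2, 3), s(2, 4), s(3, 4)} : Finset (Sym2 (Fin 5))), ¬z.IsDiag := by decide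
    exact fun z hz => hT z (hsub hz)
  by_cases hK : K.Nonempty
  · exact lsm_of_pinned_fin5 w hw D K e f hDK heD heK hfD hfK hef hL hK
  rw [Finset.not_nonempty_iff_eq_empty] at hK
  subst hK
  by_cases hfull : ({s(0, 2), s(0, 3), s(0, 4), s(1, 2), s(1, 3), s(1, 4), s(2, 3), s(2, 4), s(3, 4)} : Finset (Sym2 (Fin 5))) ⊆ D ∪ insert e (insert f (∅ : Finset (Sym2 (Fin 5))))
  · exact K5e_full_top w hw D e f hsub hfull heD hfD hef
  · obtain ⟨g, hg, hgn⟩ := Finset.not_subset.1 hfull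
    have hsub' : D ∪ insert e (insert f (∅ : Finset (Sym2 (Fin 5)))) ⊆ (({s(0, 2), s(0, 3), s(0, 4), s(1, 2), s(1, 3), s(1, 4), s(2, 3), s(2, 4), s(3, 4)} : Finset (Sym2 (Fin 5)))).erase g :=
      fun z hz => Finset.mem_erase.2 ⟨fun h => hgn (h ▸ hz), hsub hz⟩
    simp only [Finset.mem_insert, Finset.mem_singleton] at hg
    rcases hg with rfl | rfl | rfl | rfl | rfl | rfl | rfl | rfl | rfl
    · exact K5e_minus_02 w hw D _ e f hsub' hDK heD heK hfD hfK hef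
    · exact K5e_minus_03 w hw D _ e f hsub' hDK heD heK hfD hfK hef
    · exact K5e_minus_04 w hw D _ e f hsub' hDK heD heK hfD hfK hef
    · exact K5e_minus_12 w hw D _ e f hsub' hDK heD heK hfD hfK hef
    · exact K5e_minus_13 w hw D _ e f hsub' hDK heD heK hfD hfK hef
    · exact K5e_minus_14 w hw D _ e f hsub' hDK heD heK hfD hfK hef
    · exact K5e_minus_23 w hw D _ e f hsub' hDK heD heK hfD hfK hef
    · exact K5e_minus_24 w hw D _ e f hsub' hDK heD heK hfD hfK hef
    · exact K5e_minus_34 w hw D _ e f hsub' hDK heD heK hfD hfK hef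

end Summit.CriticalPhenomena.PercolationContinuityZ3.Theorems.ForestRayleigh
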